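import Literature.MathematicalPhysics.QuantumFieldTheory.Balaban1983to89.B8Eq131CubesRecDictionary
import Literature.MathematicalPhysics.QuantumFieldTheory.Balaban1983to89.B8Eq131CubesAdmissible

/-!
# `Balaban1983to89.B8Eq131CubesAdmissibleRec` (§1 only) — [Balaban1985RegularSpaces] p. 99: the Sect. F cube family AS A DOMAIN SEQUENCE `j ↦ Ω_j` («{□_j}», or
# «(T, □₁, …, □_k)»), ON THE RECORD's CENTRED tower ([Balaban1987RG1] (0.3)) — the record twin of `B8Eq131CubesAdmissible.cubeFam` and its reading lemmas (LEAD PEN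
# dag-n05-e; typed by cell member dag-n07-w3 as the input letter of the R6∕R7 interface carrier `Node00.CubeB8DZ`)

statement-level skeleton of published objects with citation tags; definitions and `simp` bookkeeping only; nothing here is a claim about the Yang–Mills mass gap

CITATION HEADER.  [6] = [Balaban1985RegularSpaces], p. 99: *«The sequence of cubes {□_j} is an admissible family of subsets satisfying (1.3), (1.4), □_k ⊂ Ω_{k−1}, □_j ⊂
Ω_j, j < k. Let us define Λ′_j = □_j^{(j)} ∖ □_{j+1}^{(j)}, j = 1, …, k − 1, Λ′_k = □_k^{(k)}, Λ′₀ = T ∖ □₁, ℭ_k = ⋃_{j=0}^{k} Λ′_j, (1.131) … U₀″ ∈ 𝔄_k({□_j}, L³α₀) ∩ Ax_k(ℭ_k,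
1), (1.132)»*; p. 77: *«we admit the case where some domains Ω_j are equal to T_η»*; [I] = [Balaban1987RG1] (0.3) p. 252 (CENTRED blocks).  Cell `pub-ymgap`, «N05-REC» road
(LEAD PEN dag-n05-e, `N05-REC-LEAD.md` TOKEN RULE (T1) `avgIter ↦ avgIterZ`, (T2) centred tower, (T5) engine names kept, definition twins `+Z`): THIS MODULE is §1 of the
record twin of `B8Eq131CubesAdmissible` — the ONE definition `cubeFam ↦ cubeFamZ` over dag-n05-d's R4e family `B8Eq131CubesRec.cubeZ` and its five reading lemmas under their
engine names, plus the `𝔄_k` reading `inAk_cubeFam_iff` and the (T2) dictionary with the engine family (`mem_cubeFamZ_iff_add_ctrShift`, via `B8Eq131CubesRecDictionary`).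
§2–§5 of the engine module (the metric clause of (1.4) `sep_cube`, `cubeFam_domainSeq`, the (1.31)∕(1.37) crossing statements) are NOT twinned here (they rest on
`B8Eq131DomainSeq`, whose record twin belongs to the lane that needs it).  `--kind definition --supports stmt-QuantumFields-20541` (K0⁷; count-neutral).

WHY.  NODE 00's dented cube datum `Node00.CubeB8D` ([Balaban1985Variational] (148)–(150)) reads its tower as `cubeFam false L a M ρ k j ∩ {j = k → · ∈ Ω_k}`, and the 43
crown modules of the R6 re-key unfold that body by `simp [CubeB8D.sq, cubeFam, …]`; the record carrier `Node00.CubeB8DZ` (dag-n07-w3, `Node00/CarriersB8CubeDentedRec`) therefore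
needs the twin letter `cubeFamZ` with the SAME definitional shape, so that a token-mapped proof script elaborates unchanged.

WHAT IS DEFINED ∕ PROVED (sorry-free).  `cubeFamZ` (definition twin); `cubeFam_of_pos`, `cubeFam_of_lt`, `cubeFam_false_zero`, `cubeFam_false_of_le`, `cubeFam_true_zero`
(engine names, `simp` proofs verbatim); `inAk_cubeFam_iff` (`𝔄_k` over `cubeFamZ false` = `𝔄_k` over `cubeZ L a M ρ k`, the family of dag-n05-d's `B8Eq131CubesRec.ineq132_cubes`);
★ `mem_cubeFamZ_iff_add_ctrShift` (odd `L`: `x ∈ cubeFamZ top … j ↔ x + c_k ∈ cubeFam top … j`, `c_k = ctrShift L k` — every level at once, the empty and the `T` members included).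
HONEST SCOPE.  One definition + bookkeeping; no estimate of [6] ∕ [I]; (1.4) for the centred family NOT asserted here (see above); `HThm4Rec` UNDISCHARGED (caveat (C-S3-1));
N05 ∕ N07 NOT discharged; counts unmoved; one finite 𝕋⁴ programme at fixed ε — R4 closes the conditional finite-𝕋⁴ rung `BalabanLadder.UV` only; the YM mass gap (Clay) is NOT
proved by any of this; nothing continuum ∕ ℝ⁴ ∕ OS.  No `instance`, no `notation`, no `sorry`.
-/

noncomputable section

namespace Literature.MathematicalPhysics.QuantumFieldTheory.Balaban1983to89.B8Eq131CubesAdmissibleRec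

-- `Site` alone would resolve to the torus sites of `Setup.lean`; re-export the `ℤᵈ` sites of `B7Prop1Explicit` (as `B8Eq131CubesRec` does).
export B7Prop1Explicit (Site)

open BlockAveragingZd (ctrShift)
open B8Eq131Cubes (cube)
open B8Eq131CubesAdmissible (cubeFam)
open B8Eq131CubesRec (cubeZ)
open B8Eq131CubesRecDictionary (mem_cubeZ_iff_add_ctrShift)

variable {d : ℕ}

/-! ## §1. The Sect. F family as a domain sequence, centred tower -/

/-- (RECORD TWIN of `B8Eq131CubesAdmissible.cubeFam`.) **THE SECT. F FAMILY AS A DOMAIN SEQUENCE** `j ↦ Ω_j` on the record's CENTRED tower: `Ω₀ = □₀` (`top = false`, the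
family `{□_j}_{j=0}^{k}` of «𝔄_k({□_j}, L³α₀)» in (1.132)) or `Ω₀ = T` (`top = true`, the family `(T, □₁, …, □_k)` whose (1.5)-territories are the `Λ′_j` of (1.131)); `Ω_j = □_j =
cubeZ … j` for `1 ≤ j ≤ k`; `Ω_j = ∅` beyond `k` — the engine body with `cube ↦ cubeZ` and nothing else.
[cite: Balaban1985RegularSpaces, p.99 («The sequence of cubes {□_j} is an admissible family»), (1.131) p.99, (1.3) p.77; Balaban1987RG1, (0.3) p.252] -/
def cubeFamZ (top : Bool) (L : ℕ) (a : Site d) (M ρ k : ℕ) : ℕ → Set (Site d) := fun j =>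
  if j ≤ k then (if top ∧ j = 0 then Set.univ else cubeZ L a M ρ k j) else ∅

/-- `Ω_j = □_j` for `1 ≤ j ≤ k` (engine name kept). [cite: Balaban1985RegularSpaces, p.99, (1.3) p.77] -/
theorem cubeFam_of_pos (top : Bool) (L : ℕ) (a : Site d) (M ρ : ℕ) {k j : ℕ} (h1 : 1 ≤ j) (hj : j ≤ k) :
    cubeFamZ top L a M ρ k j = cubeZ L a M ρ k j := by
  have : ¬ (top ∧ j = 0) := fun h => by omega
  simp [cubeFamZ, hj, this]

/-- `Ω_j = ∅` for `k < j` (engine name kept). [cite: Balaban1985RegularSpaces, (1.3) p.77, dictionary] -/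
theorem cubeFam_of_lt (top : Bool) (L : ℕ) (a : Site d) (M ρ : ℕ) {k j : ℕ} (hj : k < j) :
    cubeFamZ top L a M ρ k j = ∅ := by
  have : ¬ j ≤ k := by omega
  simp [cubeFamZ, this]

/-- `Ω₀ = □₀` for the family `{□_j}_{j=0}^{k}` (engine name kept). [cite: Balaban1985RegularSpaces, p.98 («□₀, □₁, …, □_{k−1}, □_k»)] -/
theorem cubeFam_false_zero (L : ℕ) (a : Site d) (M ρ k : ℕ) : cubeFamZ false L a M ρ k 0 = cubeZ L a M ρ k 0 := by
  simp [cubeFamZ]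

/-- `Ω_j = □_j` for every `j ≤ k` in the family `{□_j}_{j=0}^{k}` — the family `B8Eq131CubesRec.cubeZ L a M ρ k` fed to `𝔄_k` by `B8Eq131CubesRec.ineq132_cubes` ((1.132), record
tower) on the levels `j ≤ k` that `𝔄_k` reads (engine name kept). [cite: Balaban1985RegularSpaces, (1.132) p.99 («U₀″ ∈ 𝔄_k({□_j}, L³α₀)»), p.98] -/
theorem cubeFam_false_of_le (L : ℕ) (a : Site d) (M ρ : ℕ) {k j : ℕ} (hj : j ≤ k) :
    cubeFamZ false L a M ρ k j = cubeZ L a M ρ k j := by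
  simp [cubeFamZ, hj]

/-- `Ω₀ = T` for the family `(T, □₁, …, □_k)` (engine name kept). [cite: Balaban1985RegularSpaces, (1.131) p.99 («Λ′₀ = T ∖ □₁»), p.77 («some domains Ω_j are equal to T_η»)] -/
theorem cubeFam_true_zero (L : ℕ) (a : Site d) (M ρ k : ℕ) : cubeFamZ true L a M ρ k 0 = Set.univ := by
  simp [cubeFamZ]

section InA

variable {𝔸 : Type*} [NormedRing 𝔸] [NormedAlgebra ℂ 𝔸]

/-- **THE FAMILY OF (1.132) IS THE ADMISSIBLE FAMILY OF THE RECORD, centred tower**: `𝔄_k({□_j}, α)` (`B8Ineq132.InAk`, which reads the levels `j ≤ k` only) over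
`cubeFamZ false` (`Ω₀ = □₀`) is `𝔄_k` over the family `B8Eq131CubesRec.cubeZ L a M ρ k` for which `B8Eq131CubesRec.ineq132_cubes` certifies «U₀″ ∈ 𝔄_k({□_j}, L³α₀)»
(engine name kept). [cite: Balaban1985RegularSpaces, (1.132) p.99 («U₀″ ∈ 𝔄_k({□_j}, L³α₀)»), (1.7)–(1.9) p.77; Balaban1987RG1, (0.4) p.253] -/
theorem inAk_cubeFam_iff (L k : ℕ) (η α : ℝ) (a : Site d) (M ρ : ℕ) (V : Site d → Fin d → 𝔸ˣ) :
    B8Ineq132.InAk L k η α (cubeFamZ false L a M ρ k) V ↔ B8Ineq132.InAk L k η α (cubeZ L a M ρ k) V := by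
  unfold B8Ineq132.InAk
  exact forall₂_congr fun j hj => by rw [cubeFam_false_of_le L a M ρ hj]

end InA

/-! ## §1b. The (T2) dictionary with the engine family: one shift `c_k = ctrShift L k` at the fine level -/

/-- ★ **Centred family ⇄ engine family** (odd `L`): `x ∈ cubeFamZ top L a M ρ k j ↔ x + c_k ∈ cubeFam top L a M ρ k j`, every `j` (the members above `k` are both `∅`, the
`T`-member is both `T`, the cubes by `B8Eq131CubesRecDictionary.mem_cubeZ_iff_add_ctrShift`). [cite: Balaban1987RG1, (0.3) p.252; Balaban1985RegularSpaces, p.98, (1.3) p.77] -/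
theorem mem_cubeFamZ_iff_add_ctrShift {L : ℕ} (hL : Odd L) (top : Bool) (a : Site d) (M ρ k j : ℕ) (x : Site d) :
    x ∈ cubeFamZ top L a M ρ k j ↔ (x + fun _ => (ctrShift L k : ℤ)) ∈ cubeFam top L a M ρ k j := by
  by_cases hj : j ≤ k
  · by_cases ht : top ∧ j = 0
    · simp [cubeFamZ, cubeFam, ht]
    · simp only [cubeFamZ, cubeFam, if_pos hj, if_neg ht]
      exact mem_cubeZ_iff_add_ctrShift hL a M ρ hj x
  · simp [cubeFamZ, cubeFam, hj]

end Literature.MathematicalPhysics.QuantumFieldTheory.Balaban1983to89.B8Eq131CubesAdmissibleRec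

end

/-! ## Axiom audit (gate whitelist: `propext`, `Classical.choice`, `Quot.sound`) -/
#print axioms Literature.MathematicalPhysics.QuantumFieldTheory.Balaban1983to89.B8Eq131CubesAdmissibleRec.mem_cubeFamZ_iff_add_ctrShift
#print axioms Literature.MathematicalPhysics.QuantumFieldTheory.Balaban1983to89.B8Eq131CubesAdmissibleRec.inAk_cubeFam_iff
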